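import Literature.NumberTheory.LFunctions.WienerIkeharaKernel
import Mathlib.MeasureTheory.Integral.Prod
import Mathlib.MeasureTheory.Integral.MeanInequalities
import Mathlib.Analysis.SpecialFunctions.ImproperIntegrals
import Mathlib.Analysis.SpecialFunctions.Integrals.Basic
import HarnessLib

/-!
# A Fejér-smoothed indicator and its band-limited Fourier representation

Topic `Literature/NumberTheory/LFunctions`.  Everything in this file is PROVED; there are no named
facts.  It packages the elementary harmonic analysis behind the "smoothed separation of variables"
used in `Literature/NumberTheory/Sieve/MoebiusShiftedPrimesSmoothedRamare.lean` (the repair of the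
first Ramaré decomposition in the proof of Proposition 5.1 of Lichtman, arXiv:2009.08969, at the
printed exponent): a weight `γ(x) = ∫_{b₁}^{b₂} K_λ(x - y) dy` (the indicator of `[b₁, b₂]`
convolved with the normalised Fejér kernel `K_λ(z) = 2λ sinc(λz)²/m₀`, `m₀ = ∫ 2 sinc²`) which

* takes values in `[0, 1]`, is within `4/(m₀λd)` of `1` at distance `≥ d` inside `[b₁, b₂]` and is
  `≤ 2/(m₀λd)` at distance `≥ d` outside (`one_sub_smoothIndicator_le`,
  `smoothIndicator_le_of_le_left`, `smoothIndicator_le_of_ge_right`);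
* is BAND-LIMITED: `γ(x) = ∫_{-2λ}^{2λ} Γ(u) e^{iux} du` with the explicit continuous
  `Γ(u) = (1 - |u|/2λ)/m₀ · ∫_{b₁}^{b₂} e^{-iuy} dy` (`smoothIndicator_eq_integral_gammaFT`, from the
  Fourier identity for the Fejér kernel, `WienerIkehara.integral_triangle_mul_exp`, and Fubini on a
  rectangle), `‖Γ(u)‖ ≤ 3/(m₀(1+|u|))` when `b₂ - b₁ ≤ 1`, `∫_{-2λ}^{2λ} ‖Γ‖ ≤ 6 log(1+2λ)/m₀`.

Inserting the band-limited representation into a double sum `∑_{p,m} c_p b_m γ(log p + log m) (pm)^{-1-it}`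
separates the variables exactly: `e^{iu(log p + log m)} (pm)^{-1-it} = (pm)^{-1-i(t-u)}`
(`cexp_mul_log_mul_cpow`), at the cost of an average over the shifts `|u| ≤ 2λ` weighted by `‖Γ‖`
(Cauchy–Schwarz `norm_sq_integral_mul_le`).  The value `m₀ = 2π` is never needed: it is carried
as the positive constant `fejerMass`.

## References

* H. L. Montgomery, R. C. Vaughan, *Multiplicative Number Theory I*, CUP 2007, §5.1 (5.15)–(5.17)
  (Fejér kernel and its transform). [MontgomeryVaughan2007]
-/

noncomputable section

open Real MeasureTheory Set Filter intervalIntegral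

namespace Literature.NumberTheory.LFunctions

namespace FejerSmoothing

open WienerIkehara

/-! ### The normalised Fejér kernel -/

/-- The mass `m₀ = ∫_ℝ 2 sinc(x)² dx` of the Fejér kernel `K₁` (`= 2π`, a value never used here). [folklore] -/
def fejerMass : ℝ := ∫ x : ℝ, 2 * sinc x ^ 2

/-- `m₀ > 0`. [folklore] -/
theorem fejerMass_pos : 0 < fejerMass := by
  have h := integral_fejer_pos one_pos
  rw [integral_fejer_eq one_pos] at h
  exact h

/-- The normalised Fejér kernel `K_λ(x) = 2λ sinc(λx)²/m₀`. [folklore] -/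
def fejerKernel (l x : ℝ) : ℝ := 2 * l * sinc (l * x) ^ 2 / fejerMass

/-- `K_λ ≥ 0`. [folklore] -/
theorem fejerKernel_nonneg {l : ℝ} (hl : 0 ≤ l) (x : ℝ) : 0 ≤ fejerKernel l x :=
  div_nonneg (fejer_nonneg hl x) fejerMass_pos.le

/-- `K_λ` is even. [folklore] -/
theorem fejerKernel_neg (l x : ℝ) : fejerKernel l (-x) = fejerKernel l x := by
  unfold fejerKernel; rw [fejer_neg]

/-- `K_λ` is continuous. [folklore] -/
theorem continuous_fejerKernel (l : ℝ) : Continuous (fejerKernel l) :=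
  (continuous_fejer l).div_const _

/-- `K_λ` is integrable (`λ > 0`). [folklore] -/
theorem integrable_fejerKernel {l : ℝ} (hl : 0 < l) : Integrable (fejerKernel l) :=
  (integrable_fejer hl).div_const _

/-- `∫_ℝ K_λ = 1` (`λ > 0`). [folklore] -/
theorem integral_fejerKernel {l : ℝ} (hl : 0 < l) : ∫ x : ℝ, fejerKernel l x = 1 := by
  unfold fejerKernel
  rw [MeasureTheory.integral_div, integral_fejer_eq hl]
  exact div_self fejerMass_pos.ne'

/-- `K_λ(x) ≤ (2/(λx²))/m₀` for `x ≠ 0`. [folklore] -/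
theorem fejerKernel_le_div {l : ℝ} (hl : 0 < l) {x : ℝ} (hx : x ≠ 0) :
    fejerKernel l x ≤ 2 / (l * x ^ 2) / fejerMass :=
  div_le_div_of_nonneg_right (fejer_le_div hl hx) fejerMass_pos.le

/-- The tail `∫_{x > d} K_λ(x) dx ≤ 2/(m₀ λ d)` (`λ, d > 0`). [folklore] -/
theorem setIntegral_Ioi_fejerKernel_le {l d : ℝ} (hl : 0 < l) (hd : 0 < d) :
    ∫ x in Ioi d, fejerKernel l x ≤ 2 / (fejerMass * l * d) := by
  have hm := fejerMass_pos
  have hint : IntegrableOn (fun x : ℝ => 2 / (l * fejerMass) * x ^ (-2 : ℝ)) (Ioi d) :=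
    (integrableOn_Ioi_rpow_of_lt (by norm_num) hd).const_mul _
  have hmono : ∫ x in Ioi d, fejerKernel l x ≤ ∫ x in Ioi d, 2 / (l * fejerMass) * x ^ (-2 : ℝ) := by
    refine setIntegral_mono_on (integrable_fejerKernel hl).integrableOn hint measurableSet_Ioi ?_
    intro x hx
    have hx0 : 0 < x := hd.trans hx
    have h1 := fejerKernel_le_div hl hx0.ne'
    have e : x ^ (-2 : ℝ) = (x ^ 2)⁻¹ := by
      rw [Real.rpow_neg hx0.le, Real.rpow_two]
    rw [e]
    calc fejerKernel l x ≤ 2 / (l * x ^ 2) / fejerMass := h1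
      _ = 2 / (l * fejerMass) * (x ^ 2)⁻¹ := by field_simp
  refine hmono.trans ?_
  rw [MeasureTheory.integral_const_mul, integral_Ioi_rpow_of_lt (by norm_num) hd]
  have e : -d ^ ((-2 : ℝ) + 1) / ((-2 : ℝ) + 1) = d⁻¹ := by
    norm_num
    rw [Real.rpow_neg_one]
  rw [e]
  rw [show 2 / (l * fejerMass) * d⁻¹ = 2 / (fejerMass * l * d) by field_simp]

/-- By evenness, `∫_{x ≤ -d} K_λ = ∫_{x > d} K_λ`. [folklore] -/
theorem setIntegral_Iic_fejerKernel_eq (l d : ℝ) :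
    ∫ x in Iic (-d), fejerKernel l x = ∫ x in Ioi d, fejerKernel l x := by
  have h := integral_comp_neg_Ioi d (fejerKernel l)
  simp_rw [fejerKernel_neg] at h
  exact h.symm

/-! ### The smoothed indicator `γ = 𝟙_{[b₁,b₂]} ∗ K_λ` -/

/-- The smoothed indicator `γ(x) = ∫_{b₁}^{b₂} K_λ(x - y) dy` of `[b₁, b₂]`. [folklore] -/
def smoothIndicator (l b₁ b₂ x : ℝ) : ℝ := ∫ y in b₁..b₂, fejerKernel l (x - y)

/-- `γ(x) = ∫_{x-b₂}^{x-b₁} K_λ(z) dz`. [folklore] -/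
theorem smoothIndicator_eq (l b₁ b₂ x : ℝ) :
    smoothIndicator l b₁ b₂ x = ∫ z in (x - b₂)..(x - b₁), fejerKernel l z := by
  unfold smoothIndicator
  exact intervalIntegral.integral_comp_sub_left (fejerKernel l) x

/-- `γ ≥ 0` (`b₁ ≤ b₂`). [folklore] -/
theorem smoothIndicator_nonneg {l b₁ b₂ : ℝ} (hl : 0 ≤ l) (hb : b₁ ≤ b₂) (x : ℝ) :
    0 ≤ smoothIndicator l b₁ b₂ x := by
  rw [smoothIndicator_eq]
  exact intervalIntegral.integral_nonneg (by linarith) fun z _ => fejerKernel_nonneg hl z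

/-- `γ ≤ 1` (`b₁ ≤ b₂`, `λ > 0`). [folklore] -/
theorem smoothIndicator_le_one {l b₁ b₂ : ℝ} (hl : 0 < l) (hb : b₁ ≤ b₂) (x : ℝ) :
    smoothIndicator l b₁ b₂ x ≤ 1 := by
  rw [smoothIndicator_eq, intervalIntegral.integral_of_le (by linarith), ← integral_fejerKernel hl]
  exact setIntegral_le_integral (integrable_fejerKernel hl)
    (Eventually.of_forall fun z => fejerKernel_nonneg hl.le z)

/-- **Inside**: at distance `≥ d` from the complement of `[b₁, b₂]`, `1 - γ(x) ≤ 4/(m₀λd)`. [folklore] -/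
theorem one_sub_smoothIndicator_le {l b₁ b₂ d x : ℝ} (hl : 0 < l) (hd : 0 < d)
    (h1 : b₁ + d ≤ x) (h2 : x + d ≤ b₂) :
    1 - smoothIndicator l b₁ b₂ x ≤ 4 / (fejerMass * l * d) := by
  set s : Set ℝ := Ioc (x - b₂) (x - b₁) with hs
  have hint := integrable_fejerKernel hl
  have hγ : smoothIndicator l b₁ b₂ x = ∫ z in s, fejerKernel l z := by
    rw [smoothIndicator_eq, intervalIntegral.integral_of_le (by linarith)]
  have hsplit := integral_add_compl (measurableSet_Ioc (a := x - b₂) (b := x - b₁)) hint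
  rw [integral_fejerKernel hl] at hsplit
  have hcompl : ∫ z in sᶜ, fejerKernel l z ≤ ∫ z in Iic (-d) ∪ Ioi d, fejerKernel l z := by
    refine setIntegral_mono_set hint.integrableOn
      (Eventually.of_forall fun z => fejerKernel_nonneg hl.le z) (Eventually.of_forall ?_)
    intro z hz
    have hz' : ¬ (x - b₂ < z ∧ z ≤ x - b₁) := hz
    rcases le_or_gt z (x - b₂) with h | h
    · left; show z ≤ -d; linarith
    · right; show d < z
      have : ¬ z ≤ x - b₁ := fun h' => hz' ⟨h, h'⟩
      push Not at this
      linarith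
  have hunion : ∫ z in Iic (-d) ∪ Ioi d, fejerKernel l z =
      (∫ z in Iic (-d), fejerKernel l z) + ∫ z in Ioi d, fejerKernel l z := by
    refine setIntegral_union ?_ measurableSet_Ioi hint.integrableOn hint.integrableOn
    rw [Set.disjoint_iff]
    intro z hz
    simp only [mem_inter_iff, mem_Iic, mem_Ioi] at hz
    linarith [hz.1, hz.2]
  have htail := setIntegral_Ioi_fejerKernel_le hl hd
  rw [setIntegral_Iic_fejerKernel_eq] at hunion
  calc 1 - smoothIndicator l b₁ b₂ x = ∫ z in sᶜ, fejerKernel l z := by rw [hγ]; linarith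
    _ ≤ (∫ z in Ioi d, fejerKernel l z) + ∫ z in Ioi d, fejerKernel l z := by
        rw [← hunion]; exact hcompl
    _ ≤ 2 / (fejerMass * l * d) + 2 / (fejerMass * l * d) := add_le_add htail htail
    _ = 4 / (fejerMass * l * d) := by ring

/-- **Outside, left**: for `x + d ≤ b₁ ≤ b₂`, `γ(x) ≤ 2/(m₀λd)`. [folklore] -/
theorem smoothIndicator_le_of_le_left {l b₁ b₂ d x : ℝ} (hl : 0 < l) (hd : 0 < d)
    (h : x + d ≤ b₁) (hb : b₁ ≤ b₂) :
    smoothIndicator l b₁ b₂ x ≤ 2 / (fejerMass * l * d) := by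
  have hint := integrable_fejerKernel hl
  rw [smoothIndicator_eq, intervalIntegral.integral_of_le (by linarith)]
  calc ∫ z in Ioc (x - b₂) (x - b₁), fejerKernel l z ≤ ∫ z in Iic (-d), fejerKernel l z := by
        refine setIntegral_mono_set hint.integrableOn
          (Eventually.of_forall fun z => fejerKernel_nonneg hl.le z) (Eventually.of_forall ?_)
        intro z hz
        show z ≤ -d
        linarith [hz.2]
    _ = ∫ z in Ioi d, fejerKernel l z := setIntegral_Iic_fejerKernel_eq l d
    _ ≤ 2 / (fejerMass * l * d) := setIntegral_Ioi_fejerKernel_le hl hd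

/-- **Outside, right**: for `b₁ ≤ b₂ ≤ x - d`, `γ(x) ≤ 2/(m₀λd)`. [folklore] -/
theorem smoothIndicator_le_of_ge_right {l b₁ b₂ d x : ℝ} (hl : 0 < l) (hd : 0 < d)
    (h : b₂ + d ≤ x) (hb : b₁ ≤ b₂) :
    smoothIndicator l b₁ b₂ x ≤ 2 / (fejerMass * l * d) := by
  have hint := integrable_fejerKernel hl
  rw [smoothIndicator_eq, intervalIntegral.integral_of_le (by linarith)]
  calc ∫ z in Ioc (x - b₂) (x - b₁), fejerKernel l z ≤ ∫ z in Ioi d, fejerKernel l z := by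
        refine setIntegral_mono_set hint.integrableOn
          (Eventually.of_forall fun z => fejerKernel_nonneg hl.le z) (Eventually.of_forall ?_)
        intro z hz
        show d < z
        linarith [hz.1]
    _ ≤ 2 / (fejerMass * l * d) := setIntegral_Ioi_fejerKernel_le hl hd

/-! ### The Fourier side: `Î`, `Γ` -/

/-- `Î(u) = ∫_{b₁}^{b₂} e^{-iuy} dy`. [folklore] -/
def indFT (b₁ b₂ u : ℝ) : ℂ := ∫ y in b₁..b₂, Complex.exp (-(Complex.I * u * y))

/-- `‖e^{-iuy}‖ = 1`. [folklore] -/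
theorem norm_cexp_neg_I_mul (u y : ℝ) : ‖Complex.exp (-(Complex.I * u * y))‖ = 1 := by
  rw [Complex.norm_exp]
  simp

/-- `‖Î(u)‖ ≤ b₂ - b₁` (`b₁ ≤ b₂`). [folklore] -/
theorem norm_indFT_le_sub {b₁ b₂ : ℝ} (hb : b₁ ≤ b₂) (u : ℝ) : ‖indFT b₁ b₂ u‖ ≤ b₂ - b₁ := by
  unfold indFT
  have h := intervalIntegral.norm_integral_le_of_norm_le_const (a := b₁) (b := b₂) (C := 1)
    (f := fun y : ℝ => Complex.exp (-(Complex.I * u * y))) (fun y _ => (norm_cexp_neg_I_mul u y).le)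
  rw [abs_of_nonneg (by linarith), one_mul] at h
  exact h

/-- `‖Î(u)‖ ≤ 2/|u|` for `u ≠ 0` (`Î(u) = (e^{-iub₂} - e^{-iub₁})/(-iu)`). [folklore] -/
theorem norm_indFT_le_div (b₁ b₂ : ℝ) {u : ℝ} (hu : u ≠ 0) : ‖indFT b₁ b₂ u‖ ≤ 2 / |u| := by
  unfold indFT
  set c : ℂ := -(Complex.I * u) with hc
  have hc0 : c ≠ 0 := by
    rw [hc, neg_ne_zero, mul_ne_zero_iff]
    exact ⟨Complex.I_ne_zero, by exact_mod_cast hu⟩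
  have hnc : ‖c‖ = |u| := by
    rw [hc, norm_neg, norm_mul, Complex.norm_I, one_mul, Complex.norm_real, Real.norm_eq_abs]
  have e : (fun y : ℝ => Complex.exp (-(Complex.I * u * y))) = fun y : ℝ => Complex.exp (c * y) := by
    funext y; rw [hc]; ring_nf
  rw [e, integral_exp_mul_complex hc0, norm_div, hnc]
  refine div_le_div_of_nonneg_right ?_ (abs_nonneg u)
  calc ‖Complex.exp (c * b₂) - Complex.exp (c * b₁)‖
      ≤ ‖Complex.exp (c * b₂)‖ + ‖Complex.exp (c * b₁)‖ := norm_sub_le _ _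
    _ = 1 + 1 := by
        rw [hc]
        have h1 := norm_cexp_neg_I_mul u b₂
        have h2 := norm_cexp_neg_I_mul u b₁
        rw [show -(Complex.I * u) * (b₂ : ℂ) = -(Complex.I * u * b₂) by ring, h1,
          show -(Complex.I * u) * (b₁ : ℂ) = -(Complex.I * u * b₁) by ring, h2]
    _ = 2 := by norm_num

/-- `Î` is continuous. [folklore] -/
theorem continuous_indFT (b₁ b₂ : ℝ) : Continuous (indFT b₁ b₂) := by
  unfold indFT
  exact intervalIntegral.continuous_parametric_intervalIntegral_of_continuous'
    (by fun_prop : Continuous (Function.uncurry fun (u y : ℝ) => Complex.exp (-(Complex.I * u * y))))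
    b₁ b₂

/-- The band-limited multiplier `Γ(u) = (1 - |u|/a)/m₀ · Î(u)` (used for `|u| ≤ a = 2λ`). [folklore] -/
def gammaFT (a b₁ b₂ u : ℝ) : ℂ := (((1 - |u| / a) / fejerMass : ℝ) : ℂ) * indFT b₁ b₂ u

/-- `Γ` is continuous. [folklore] -/
theorem continuous_gammaFT (a b₁ b₂ : ℝ) : Continuous (gammaFT a b₁ b₂) := by
  unfold gammaFT
  exact (Complex.continuous_ofReal.comp (by fun_prop)).mul (continuous_indFT b₁ b₂)

/-- `‖Γ(u)‖ ≤ 3/(m₀(1+|u|))` for `|u| ≤ a`, when `0 ≤ b₂ - b₁ ≤ 1`. [folklore] -/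
theorem norm_gammaFT_le {a b₁ b₂ u : ℝ} (ha : 0 < a) (hb : b₁ ≤ b₂) (hlen : b₂ - b₁ ≤ 1)
    (hu : |u| ≤ a) : ‖gammaFT a b₁ b₂ u‖ ≤ 3 / (fejerMass * (1 + |u|)) := by
  have hm := fejerMass_pos
  have htri0 : 0 ≤ 1 - |u| / a := by
    rw [sub_nonneg, div_le_one ha]; exact hu
  have htri1 : 1 - |u| / a ≤ 1 := by
    have : 0 ≤ |u| / a := div_nonneg (abs_nonneg u) ha.le
    linarith
  unfold gammaFT
  rw [norm_mul, Complex.norm_real, Real.norm_eq_abs, abs_of_nonneg (div_nonneg htri0 hm.le)]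
  -- `‖Î(u)‖ ≤ 3/(1+|u|)`
  have hI : ‖indFT b₁ b₂ u‖ ≤ 3 / (1 + |u|) := by
    have hu0 : 0 ≤ |u| := abs_nonneg u
    rcases le_or_gt |u| 2 with h2 | h2
    · calc ‖indFT b₁ b₂ u‖ ≤ b₂ - b₁ := norm_indFT_le_sub hb u
        _ ≤ 1 := hlen
        _ ≤ 3 / (1 + |u|) := by rw [le_div_iff₀ (by linarith)]; linarith
    · have hu1 : u ≠ 0 := by
        intro h0; rw [h0, abs_zero] at h2; linarith
      calc ‖indFT b₁ b₂ u‖ ≤ 2 / |u| := norm_indFT_le_div b₁ b₂ hu1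
        _ ≤ 3 / (1 + |u|) := by
            rw [div_le_div_iff₀ (by linarith) (by linarith)]; linarith
  calc (1 - |u| / a) / fejerMass * ‖indFT b₁ b₂ u‖ ≤ 1 / fejerMass * (3 / (1 + |u|)) := by
        refine mul_le_mul (div_le_div_of_nonneg_right htri1 hm.le) hI (norm_nonneg _) (by positivity)
    _ = 3 / (fejerMass * (1 + |u|)) := by field_simp

/-- `∫_{-a}^{a} ‖Γ(u)‖ du ≤ 6 log(1+a)/m₀` (`a > 0`, `0 ≤ b₂ - b₁ ≤ 1`). [folklore] -/
theorem integral_norm_gammaFT_le {a b₁ b₂ : ℝ} (ha : 0 < a) (hb : b₁ ≤ b₂) (hlen : b₂ - b₁ ≤ 1) :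
    ∫ u in -a..a, ‖gammaFT a b₁ b₂ u‖ ≤ 6 * Real.log (1 + a) / fejerMass := by
  have hm := fejerMass_pos
  set h : ℝ → ℝ := fun u => 3 / (fejerMass * (1 + |u|)) with hh
  have hhc : Continuous h := by
    rw [hh]
    refine Continuous.div continuous_const (by fun_prop) fun u => ?_
    have : 0 ≤ |u| := abs_nonneg u
    positivity
  have hgc : Continuous fun u => ‖gammaFT a b₁ b₂ u‖ := (continuous_gammaFT a b₁ b₂).norm
  -- compare with the even majorant `h`
  have h1 : ∫ u in -a..a, ‖gammaFT a b₁ b₂ u‖ ≤ ∫ u in -a..a, h u := by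
    refine intervalIntegral.integral_mono_on (by linarith) (hgc.intervalIntegrable _ _)
      (hhc.intervalIntegrable _ _) fun u hu => ?_
    exact norm_gammaFT_le ha hb hlen (abs_le.mpr ⟨by linarith [hu.1], hu.2⟩)
  refine h1.trans ?_
  -- `∫_{-a}^{a} h = 2 ∫_0^a h` and `∫_0^a 3/(m₀(1+u)) du = 3 log(1+a)/m₀`
  have hsplit : ∫ u in -a..a, h u = (∫ u in -a..0, h u) + ∫ u in (0:ℝ)..a, h u :=
    (intervalIntegral.integral_add_adjacent_intervals (hhc.intervalIntegrable _ _)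
      (hhc.intervalIntegrable _ _)).symm
  have hneg : ∫ u in -a..0, h u = ∫ u in (0:ℝ)..a, h u := by
    have e : (fun u => h u) = fun u => h (-u) := by
      funext u; simp only [hh, abs_neg]
    conv_lhs => rw [e]
    rw [intervalIntegral.integral_comp_neg]
    simp
  have hpos : ∫ u in (0:ℝ)..a, h u = 3 / fejerMass * Real.log (1 + a) := by
    have e : ∀ u ∈ Set.uIcc (0:ℝ) a, h u = 3 / fejerMass * (1 / (1 + u)) := by
      intro u hu
      rw [Set.uIcc_of_le ha.le] at hu
      simp only [hh, abs_of_nonneg hu.1]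
      field_simp
    rw [intervalIntegral.integral_congr e, intervalIntegral.integral_const_mul]
    have h2 : ∫ u in (0:ℝ)..a, 1 / (1 + u) = Real.log (1 + a) := by
      have := intervalIntegral.integral_comp_add_left (fun v : ℝ => 1 / v) (1 : ℝ) (a := 0) (b := a)
      simp only [add_zero] at this
      rw [this, integral_one_div_of_pos one_pos (by linarith), div_one]
    rw [h2]
  have e6 : 3 / fejerMass * Real.log (1 + a) + 3 / fejerMass * Real.log (1 + a) =
      6 * Real.log (1 + a) / fejerMass := by ring
  rw [hsplit, hneg, hpos, e6]

/-! ### Fubini on a rectangle and the band-limited representation of `γ` -/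

/-- Interchanging two interval integrals of a jointly continuous function. [folklore] -/
theorem intervalIntegral_swap_of_continuous {E : Type*} [NormedAddCommGroup E] [NormedSpace ℝ E]
    {f : ℝ → ℝ → E} (hf : Continuous (Function.uncurry f))
    {a₁ a₂ c₁ c₂ : ℝ} (ha : a₁ ≤ a₂) (hc : c₁ ≤ c₂) :
    ∫ u in a₁..a₂, ∫ y in c₁..c₂, f u y = ∫ y in c₁..c₂, ∫ u in a₁..a₂, f u y := by
  simp_rw [intervalIntegral.integral_of_le ha, intervalIntegral.integral_of_le hc]
  refine MeasureTheory.integral_integral_swap ?_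
  rw [Measure.prod_restrict, ← Measure.volume_eq_prod]
  exact ((hf.continuousOn).integrableOn_compact (isCompact_Icc.prod isCompact_Icc)).mono_set
    (Set.prod_mono Ioc_subset_Icc_self Ioc_subset_Icc_self)

/-- **Band-limited representation of `γ`**: for `λ > 0`, `b₁ ≤ b₂` and real `x`,
`γ(x) = ∫_{-2λ}^{2λ} Γ(u) e^{iux} du` with `Γ = gammaFT (2λ) b₁ b₂`
(the Fourier identity `∫_{-2λ}^{2λ} (1 - |u|/2λ) e^{iuz} du = 2λ sinc(λz)²` and Fubini).
[cite: MontgomeryVaughan2007, §5.1 eq. (5.17)] -/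
theorem smoothIndicator_eq_integral_gammaFT {l b₁ b₂ : ℝ} (hl : 0 < l) (hb : b₁ ≤ b₂) (x : ℝ) :
    (smoothIndicator l b₁ b₂ x : ℂ) =
      ∫ u in -(2 * l)..(2 * l), gammaFT (2 * l) b₁ b₂ u * Complex.exp (Complex.I * u * x) := by
  have hm := fejerMass_pos
  set F : ℝ → ℝ → ℂ := fun u y =>
    (((1 - |u| / (2 * l)) / fejerMass : ℝ) : ℂ) * Complex.exp (Complex.I * u * (x - y)) with hF
  have hFc : Continuous (Function.uncurry F) := by
    rw [hF]
    exact (Complex.continuous_ofReal.comp (by fun_prop)).mul (by fun_prop)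
  -- the integrand as an inner integral
  have hinner : ∀ u : ℝ, gammaFT (2 * l) b₁ b₂ u * Complex.exp (Complex.I * u * x) =
      ∫ y in b₁..b₂, F u y := by
    intro u
    unfold gammaFT indFT
    rw [mul_comm, ← mul_assoc, ← intervalIntegral.integral_const_mul]
    refine intervalIntegral.integral_congr fun y _ => ?_
    simp only [hF]
    rw [show Complex.I * u * ((x : ℂ) - y) = Complex.I * u * x + -(Complex.I * u * y) by ring,
      Complex.exp_add]
    ring
  simp_rw [hinner]
  rw [intervalIntegral_swap_of_continuous hFc (by linarith) hb]
  -- the inner `u`-integral is the Fejér kernel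
  have hker : ∀ y : ℝ, ∫ u in -(2 * l)..(2 * l), F u y = ((fejerKernel l (x - y) : ℝ) : ℂ) := by
    intro y
    have h1 := integral_triangle_mul_exp hl (x - y)
    simp only [hF]
    have e : (fun u : ℝ => (((1 - |u| / (2 * l)) / fejerMass : ℝ) : ℂ) *
        Complex.exp (Complex.I * u * ((x : ℂ) - y))) = fun u : ℝ =>
        ((1 / fejerMass : ℝ) : ℂ) * ((((1 - |u| / (2 * l) : ℝ)) : ℂ) *
          Complex.exp (Complex.I * u * ((x - y : ℝ) : ℂ))) := by
      funext u; push_cast; ring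
    rw [e, intervalIntegral.integral_const_mul, h1]
    unfold fejerKernel
    push_cast
    ring
  simp_rw [hker]
  rw [intervalIntegral.integral_ofReal]
  rfl

/-! ### Two tools for the consumer: Cauchy–Schwarz and the shift identity -/

/-- A continuous real function lies in every `L^p((a, b])`. [folklore] -/
theorem memLp_restrict_Ioc_of_continuous {f : ℝ → ℝ} (hf : Continuous f) (a b : ℝ) (p : ENNReal) :
    MemLp f p (volume.restrict (Set.Ioc a b)) := by
  haveI : Fact (volume (Set.Ioc a b) < ⊤) := ⟨measure_Ioc_lt_top⟩
  obtain ⟨C, hC⟩ := (isCompact_Icc (a := a) (b := b)).exists_bound_of_continuousOn hf.continuousOn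
  refine memLp_of_bounded (a := -C) (b := C) ?_ hf.aestronglyMeasurable p
  rw [ae_restrict_iff' measurableSet_Ioc]
  refine Filter.Eventually.of_forall fun η hη => ?_
  have h := hC η (Set.Ioc_subset_Icc_self hη)
  rw [Real.norm_eq_abs] at h
  exact ⟨by linarith [neg_abs_le (f η)], (le_abs_self _).trans h⟩

/-- **Cauchy–Schwarz with a complex weight**: for continuous `w, F` and `a ≤ b`,
`‖∫_a^b w F‖² ≤ (∫_a^b ‖w‖) · ∫_a^b ‖w‖ ‖F‖²`. [folklore] -/
theorem norm_sq_integral_mul_le {w F : ℝ → ℂ} (hw : Continuous w) (hF : Continuous F) {a b : ℝ}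
    (hab : a ≤ b) :
    ‖∫ u in a..b, w u * F u‖ ^ 2 ≤ (∫ u in a..b, ‖w u‖) * ∫ u in a..b, ‖w u‖ * ‖F u‖ ^ 2 := by
  have h1 : ‖∫ u in a..b, w u * F u‖ ≤ ∫ u in a..b, ‖w u‖ * ‖F u‖ := by
    refine (intervalIntegral.norm_integral_le_integral_norm hab).trans (le_of_eq ?_)
    exact intervalIntegral.integral_congr fun u _ => norm_mul _ _
  have hA0 : 0 ≤ ∫ u in a..b, ‖w u‖ :=
    intervalIntegral.integral_nonneg hab fun u _ => norm_nonneg _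
  have hB0 : 0 ≤ ∫ u in a..b, ‖w u‖ * ‖F u‖ ^ 2 :=
    intervalIntegral.integral_nonneg hab fun u _ => by positivity
  -- Hölder with `f = √‖w‖`, `g = √‖w‖ ‖F‖`
  have hfc : Continuous fun u => Real.sqrt ‖w u‖ := by fun_prop
  have hgc : Continuous fun u => Real.sqrt ‖w u‖ * ‖F u‖ := by fun_prop
  have hfg : ∀ u, Real.sqrt ‖w u‖ * (Real.sqrt ‖w u‖ * ‖F u‖) = ‖w u‖ * ‖F u‖ := fun u => by
    rw [← mul_assoc, Real.mul_self_sqrt (norm_nonneg _)]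
  have hf2 : ∀ u, Real.sqrt ‖w u‖ ^ (2 : ℝ) = ‖w u‖ := fun u => by
    rw [Real.rpow_two, Real.sq_sqrt (norm_nonneg _)]
  have hg2 : ∀ u, (Real.sqrt ‖w u‖ * ‖F u‖) ^ (2 : ℝ) = ‖w u‖ * ‖F u‖ ^ 2 := fun u => by
    rw [Real.rpow_two, mul_pow, Real.sq_sqrt (norm_nonneg _)]
  have h2 := integral_mul_le_Lp_mul_Lq_of_nonneg (μ := volume.restrict (Set.Ioc a b))
    (f := fun u => Real.sqrt ‖w u‖) (g := fun u => Real.sqrt ‖w u‖ * ‖F u‖)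
    Real.HolderConjugate.two_two (Filter.Eventually.of_forall fun u => Real.sqrt_nonneg _)
    (Filter.Eventually.of_forall fun u => by positivity)
    (memLp_restrict_Ioc_of_continuous hfc a b _) (memLp_restrict_Ioc_of_continuous hgc a b _)
  simp only [hfg, hf2, hg2] at h2
  rw [← intervalIntegral.integral_of_le hab, ← intervalIntegral.integral_of_le hab,
    ← intervalIntegral.integral_of_le hab] at h2
  have h3 : (∫ u in a..b, ‖w u‖ * ‖F u‖) ^ 2 ≤
      (∫ u in a..b, ‖w u‖) * ∫ u in a..b, ‖w u‖ * ‖F u‖ ^ 2 := by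
    have h4 := pow_le_pow_left₀ (intervalIntegral.integral_nonneg hab fun u _ => by positivity) h2 2
    refine h4.trans (le_of_eq ?_)
    rw [mul_pow, ← Real.rpow_natCast, ← Real.rpow_natCast, ← Real.rpow_mul hA0, ← Real.rpow_mul hB0]
    norm_num
  calc ‖∫ u in a..b, w u * F u‖ ^ 2 ≤ (∫ u in a..b, ‖w u‖ * ‖F u‖) ^ 2 :=
        pow_le_pow_left₀ (norm_nonneg _) h1 2
    _ ≤ _ := h3

/-- **The shift identity**: `e^{iu log n} · n^{-1-it} = n^{-1-i(t-u)}` for `n ≥ 1`. [folklore] -/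
theorem cexp_mul_log_mul_cpow {n : ℕ} (hn : n ≠ 0) (u t : ℝ) :
    Complex.exp (Complex.I * u * Real.log n) * (n : ℂ) ^ (-(1 + (t : ℂ) * Complex.I)) =
      (n : ℂ) ^ (-(1 + ((t - u : ℝ) : ℂ) * Complex.I)) := by
  have hn' : (n : ℂ) ≠ 0 := by exact_mod_cast hn
  rw [Complex.cpow_def_of_ne_zero hn', Complex.cpow_def_of_ne_zero hn', ← Complex.exp_add,
    Complex.natCast_log]
  congr 1
  push_cast
  ring

end FejerSmoothing

end Literature.NumberTheory.LFunctions
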